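import Literature.Probability.Percolation.LonelyClusterExchange
import Literature.Probability.LatticeModels.ProdBernoulliIndependence
import HarnessLib

/-!
# `NoHeavyLowerTail` (stmt-CriticalPhenomena-4575) — CLUSTER UP-SET LIGHTNESS TRANSFER ("CATCH") and the
# generalised self-gluing dominance GTOP in its `G`-order form

Support file (prover `prim-hp-8`, PL programme; `--supports stmt-CriticalPhenomena-4575`).  No definitions, no named
facts, no sorries.

Bond percolation `μ = prodBernoulli w` with arbitrary edge probabilities on a finite vertex type, relays `A`, level `j`,
`R_v = {|π(v)| ≤ j}` (`π(v)` = relays joined to `v`; "`v` is light").  For two vertices `c ≠ x` with `μ(R_x) ≤ μ(R_c)`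
("`c` is at least as light-prone as `x`") and ANY event `U` that is an up-set of the open edge cluster `C_c` of `c`
(`ω ∈ U`, `C_c(ω) ⊆ C_c(ω′)` ⇒ `ω′ ∈ U`):

* `clusterUpset_transfer` (**CATCH**):  `μ(U ∩ R_c) − μ(U ∩ R_x) ≤ μ(U) · (μ(R_c) − μ(R_x))`, i.e.
  `Cov(1_U, 1_{R_x} − 1_{R_c}) ≥ 0`: penalising `c` by conditioning on an up-set of its own cluster shrinks `c`'s
  lightness advantage over `x` at least proportionally.  Proof: on `{c ↔ x}` the two lightness events coincide; on
  `D = {c ↮ x}` two instances of the two-cluster exchange inequality (`twoClusterExchange`, BHK 2006 Thm. 1.5: `U` and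
  `R_x` are of type `(+)`, `R_c` of type `(−)` for the pair `(c, x)`) give
  `μ(DUR_c) − μ(DUR_x) ≤ (μ(DU)/μ(D)) · (μ(DR_c) − μ(DR_x))`, and Harris (`U` increasing, `D` decreasing) bounds the
  factor by `μ(U)`.  It sharpens the tree's `lonelyClusterTransfer_typeMinus` (factor `1`) for `B = U`.
* `openConnIn_mono_of_openEdgeCluster`: the relay-free attachment event `{c ∈ π⁰(o)} = {o ↔ c inside (V∖A) ∪ {c}}` is an
  up-set of `C_c`.
* `gtop` (**GTOP, `G`-order form**; memo PROOF-COIN-REDUCTION.md §10 (N2), census 0 / 137 357 with the `G`-order):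
  `Cov(1{c ∈ π⁰(o)}, 1_{R_x} − 1_{R_c}) ≥ 0` whenever `μ(R_x) ≤ μ(R_c)` — "being reached relay-free by the observer hurts
  `c`'s lightness at least as much as `x`'s".  The star case `U = {coin o–c open}` is the self-gluing dominance
  TOP″ (`CoinReduction.selfGluingLoss_ge_general`) in its `G`-order form.
-/

noncomputable section

namespace Summit.CriticalPhenomena.PercolationContinuityZ3.Theorems

namespace CoinReduction

open MeasureTheory Set Literature.Probability.LatticeModels Literature.Probability.Percolation
open scoped Classical

variable {V : Type*} [Fintype V]

open LonelyClusterExchange in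
/-- **CATCH (cluster up-set lightness transfer).**  `c ≠ x`, `μ(R_x) ≤ μ(R_c)`, `U` an up-set of the open edge
cluster of `c`.  Then `μ(U ∩ R_c) − μ(U ∩ R_x) ≤ μ(U) · (μ(R_c) − μ(R_x))`.
[cite: VandenbergHaggstromKahn2005, Thm. 1.5 (p. 7) — via `twoClusterExchange`; Harris] -/
theorem clusterUpset_transfer (w : Sym2 V → unitInterval) {c x : V} (hcx : c ≠ x) (A : Finset V) (j : ℕ)
    {U : Set (BondConfig V)}
    (hU : ∀ ⦃ω ω' : BondConfig V⦄, openEdgeCluster ω c ⊆ openEdgeCluster ω' c → ω ∈ U → ω' ∈ U)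
    (hle : (prodBernoulli w).real {ω : BondConfig V | (A.filter fun z => ω ∈ openConn x z).card ≤ j} ≤
      (prodBernoulli w).real {ω : BondConfig V | (A.filter fun z => ω ∈ openConn c z).card ≤ j}) :
    (prodBernoulli w).real (U ∩ {ω : BondConfig V | (A.filter fun z => ω ∈ openConn c z).card ≤ j}) -
        (prodBernoulli w).real (U ∩ {ω : BondConfig V | (A.filter fun z => ω ∈ openConn x z).card ≤ j}) ≤
      (prodBernoulli w).real U *
        ((prodBernoulli w).real {ω : BondConfig V | (A.filter fun z => ω ∈ openConn c z).card ≤ j} -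
          (prodBernoulli w).real {ω : BondConfig V | (A.filter fun z => ω ∈ openConn x z).card ≤ j}) := by
  set μ := prodBernoulli w with hμ
  set Rc : Set (BondConfig V) := {ω | (A.filter fun z => ω ∈ openConn c z).card ≤ j} with hRc
  set Rx : Set (BondConfig V) := {ω | (A.filter fun z => ω ∈ openConn x z).card ≤ j} with hRx
  set D : Set (BondConfig V) := (openConn c x)ᶜ with hD
  have hmeas : ∀ S : Set (BondConfig V), MeasurableSet S := fun S => (Set.toFinite S).measurableSet
  -- type hypotheses for the pair (c, x)
  have hUt : ∀ ⦃ω ω' : BondConfig V⦄, openEdgeCluster ω c ⊆ openEdgeCluster ω' c →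
      openEdgeCluster ω' x ⊆ openEdgeCluster ω x → ω ∈ U → ω' ∈ U := fun ω ω' h1 _ h => hU h1 h
  have hΩp : ∀ ⦃ω ω' : BondConfig V⦄, openEdgeCluster ω c ⊆ openEdgeCluster ω' c →
      openEdgeCluster ω' x ⊆ openEdgeCluster ω x → ω ∈ (univ : Set (BondConfig V)) → ω' ∈ (univ : Set _) :=
    fun _ _ _ _ _ => mem_univ _
  have hΩm : ∀ ⦃ω ω' : BondConfig V⦄, openEdgeCluster ω' c ⊆ openEdgeCluster ω c →
      openEdgeCluster ω x ⊆ openEdgeCluster ω' x → ω ∈ (univ : Set (BondConfig V)) → ω' ∈ (univ : Set _) :=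
    fun _ _ _ _ _ => mem_univ _
  -- (α): U (+) against R_c (−)
  have hα : μ.real (D ∩ (U ∩ Rc)) * μ.real D ≤ μ.real (D ∩ U) * μ.real (D ∩ Rc) := by
    have h := twoClusterExchange w hcx (A₁ := U) (A₂ := univ) (B₁ := Rc) (B₂ := univ)
      hUt hΩp (typeMinus_card_le A j c x) hΩm
    simpa only [inter_univ, univ_inter] using h
  -- (β): U (+) with R_x (+)
  have hβ : μ.real (D ∩ U) * μ.real (D ∩ Rx) ≤ μ.real (D ∩ (U ∩ Rx)) * μ.real D := by
    have h := twoClusterExchange w hcx (A₁ := U) (A₂ := Rx) (B₁ := univ) (B₂ := univ)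
      hUt (typePlus_card_le A j c x) hΩm hΩm
    simpa only [inter_univ, univ_inter] using h
  -- Harris: U increasing, D decreasing
  have hUup : IsUpperSet U := fun ω ω' hωω' hω => hU (BHK2006.openEdgeCluster_mono hωω' c) hω
  have hDlow : IsLowerSet D := by
    intro ω ω' hω'ω hω h
    exact hω ((h : (openGraph ω').Reachable c x).mono (BHK2006.openGraph_le hω'ω))
  have hH : μ.real (D ∩ U) ≤ μ.real U * μ.real D := by
    rw [inter_comm]
    exact prodBernoulli_harris_upper_lower w hUup hDlow (hmeas U) (hmeas D)
  -- on {c ↔ x} the lightness events coincide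
  have hRD : ∀ S : Set (BondConfig V), (S ∩ Rc) \ D = (S ∩ Rx) \ D := by
    intro S
    ext ω
    simp only [hRc, hRx, hD, mem_sdiff, mem_inter_iff, mem_compl_iff, not_not, mem_setOf_eq]
    constructor
    · rintro ⟨⟨hS, h⟩, hcx'⟩
      have hcx'' : (openGraph ω).Reachable c x := hcx'
      have heq : (A.filter fun z => ω ∈ openConn x z) = (A.filter fun z => ω ∈ openConn c z) :=
        Finset.filter_congr fun z _ =>
          ⟨fun hz => (hcx''.trans hz : (openGraph ω).Reachable c z),
            fun hz => (hcx''.symm.trans hz : (openGraph ω).Reachable x z)⟩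
      rw [heq]
      exact ⟨⟨hS, h⟩, hcx'⟩
    · rintro ⟨⟨hS, h⟩, hcx'⟩
      have hcx'' : (openGraph ω).Reachable c x := hcx'
      have heq : (A.filter fun z => ω ∈ openConn c z) = (A.filter fun z => ω ∈ openConn x z) :=
        Finset.filter_congr fun z _ =>
          ⟨fun hz => (hcx''.symm.trans hz : (openGraph ω).Reachable x z),
            fun hz => (hcx''.trans hz : (openGraph ω).Reachable c z)⟩
      rw [heq]
      exact ⟨⟨hS, h⟩, hcx'⟩
  have hsplit : ∀ S : Set (BondConfig V), μ.real (S ∩ Rc) - μ.real (S ∩ Rx) =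
      μ.real (D ∩ (S ∩ Rc)) - μ.real (D ∩ (S ∩ Rx)) := by
    intro S
    have h1 : μ.real ((S ∩ Rc) ∩ D) + μ.real ((S ∩ Rc) \ D) = μ.real (S ∩ Rc) :=
      measureReal_inter_add_sdiff (hmeas D)
    have h2 : μ.real ((S ∩ Rx) ∩ D) + μ.real ((S ∩ Rx) \ D) = μ.real (S ∩ Rx) :=
      measureReal_inter_add_sdiff (hmeas D)
    rw [hRD S] at h1
    rw [inter_comm D (S ∩ Rc), inter_comm D (S ∩ Rx)]
    linarith
  have hgap : μ.real Rc - μ.real Rx = μ.real (D ∩ Rc) - μ.real (D ∩ Rx) := by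
    simpa only [univ_inter] using hsplit univ
  rw [hsplit U, hgap]
  have hgap0 : 0 ≤ μ.real (D ∩ Rc) - μ.real (D ∩ Rx) := by
    rw [← hgap]; simpa only [hRc, hRx] using sub_nonneg.2 hle
  have ha : μ.real (D ∩ (U ∩ Rc)) ≤ μ.real D := measureReal_mono inter_subset_left
  have hb : 0 ≤ μ.real (D ∩ (U ∩ Rx)) := measureReal_nonneg
  have hUn : 0 ≤ μ.real U := measureReal_nonneg
  rcases (measureReal_nonneg : 0 ≤ μ.real D).eq_or_lt with hd0 | hdpos
  · -- μ(D) = 0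
    have ha0 : μ.real (D ∩ (U ∩ Rc)) = 0 := le_antisymm (hd0 ▸ ha) measureReal_nonneg
    rw [ha0]
    nlinarith
  · -- μ(D) > 0: (a − b)·d ≤ u·(rc − rx) ≤ μ(U)·d·(rc − rx)
    have h1 : (μ.real (D ∩ (U ∩ Rc)) - μ.real (D ∩ (U ∩ Rx))) * μ.real D ≤
        μ.real (D ∩ U) * (μ.real (D ∩ Rc) - μ.real (D ∩ Rx)) := by nlinarith
    have h2 : μ.real (D ∩ U) * (μ.real (D ∩ Rc) - μ.real (D ∩ Rx)) ≤
        μ.real U * (μ.real (D ∩ Rc) - μ.real (D ∩ Rx)) * μ.real D := by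
      have := mul_le_mul_of_nonneg_right hH hgap0
      nlinarith
    exact le_of_mul_le_mul_right (h1.trans h2) hdpos

omit [Fintype V] in
/-- **Relay-free attachment is an up-set of the target's cluster.**  If `o ↔ c` inside `S` in `ω` and `C_c(ω) ⊆ C_c(ω′)`,
then `o ↔ c` inside `S` in `ω′` (every edge of the witnessing path lies in `C_c(ω)`). [folklore] -/
theorem openConnIn_mono_of_openEdgeCluster {S : Set V} {o c : V} ⦃ω ω' : BondConfig V⦄
    (hC : openEdgeCluster ω c ⊆ openEdgeCluster ω' c) (h : ω ∈ openConnIn S o c) : ω' ∈ openConnIn S o c := by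
  obtain ⟨ho, hc, hreach⟩ := h
  refine ⟨ho, hc, ?_⟩
  -- walks in the induced open graph of ω ending at c transfer to ω'
  set H₁ := (openGraph ω).induce S with hH₁
  set H₂ := (openGraph ω').induce S with hH₂
  have key : ∀ (u v : S) (p : H₁.Walk u v), (openGraph ω).Reachable c v → H₂.Reachable u v := by
    intro u v p
    induction p with
    | nil => exact fun _ => SimpleGraph.Reachable.refl _
    | @cons u u' v hadj q ih =>
      intro hcv
      -- u' and u are joined to c in openGraph ω
      have hu'c : (openGraph ω).Reachable c u' :=
        hcv.trans (q.reachable.map (SimpleGraph.Embedding.induce S).toHom).symm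
      have huc : (openGraph ω).Reachable c u :=
        hcv.trans ((SimpleGraph.Walk.cons hadj q).reachable.map (SimpleGraph.Embedding.induce S).toHom).symm
      have hadj' : (openGraph ω).Adj u u' := hadj
      rw [openGraph_adj] at hadj'
      have hmem : s((u : V), (u' : V)) ∈ openEdgeCluster ω c := by
        refine ⟨hadj'.1, ?_, ?_⟩
        · rw [Sym2.mk_isDiag_iff]; exact hadj'.2
        · intro z hz
          rw [Sym2.mem_iff] at hz
          rcases hz with rfl | rfl
          · exact huc
          · exact hu'c
      have hmem' := hC hmem
      have hadj2 : H₂.Adj u u' := by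
        show (openGraph ω').Adj u u'
        rw [openGraph_adj]
        exact ⟨hmem'.1, hadj'.2⟩
      exact hadj2.reachable.trans (ih hcv)
  obtain ⟨p⟩ := hreach
  exact key ⟨o, ho⟩ ⟨c, hc⟩ p (SimpleGraph.Reachable.refl _)

/-- **GTOP (`G`-order form).**  For an observer `o`, relays `A`, level `j` and two vertices `c ≠ x` with
`μ(R_x) ≤ μ(R_c)`, with `P_c = {o ↔ c inside (V ∖ A) ∪ {c}}` ("`c ∈ π⁰(o)`"):
`μ(P_c ∩ R_c) − μ(P_c ∩ R_x) ≤ μ(P_c) · (μ(R_c) − μ(R_x))`, i.e. `Cov(1_{P_c}, 1_{R_x} − 1_{R_c}) ≥ 0`.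
[cite: VandenbergHaggstromKahn2005, Thm. 1.5 (p. 7) — via `clusterUpset_transfer`] -/
theorem gtop (w : Sym2 V → unitInterval) (A : Finset V) (j : ℕ) {o c x : V} (hcx : c ≠ x)
    (hle : (prodBernoulli w).real {ω : BondConfig V | (A.filter fun z => ω ∈ openConn x z).card ≤ j} ≤
      (prodBernoulli w).real {ω : BondConfig V | (A.filter fun z => ω ∈ openConn c z).card ≤ j}) :
    (prodBernoulli w).real (openConnIn ((↑A : Set V)ᶜ ∪ {c}) o c ∩
          {ω : BondConfig V | (A.filter fun z => ω ∈ openConn c z).card ≤ j}) -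
        (prodBernoulli w).real (openConnIn ((↑A : Set V)ᶜ ∪ {c}) o c ∩
          {ω : BondConfig V | (A.filter fun z => ω ∈ openConn x z).card ≤ j}) ≤
      (prodBernoulli w).real (openConnIn ((↑A : Set V)ᶜ ∪ {c}) o c) *
        ((prodBernoulli w).real {ω : BondConfig V | (A.filter fun z => ω ∈ openConn c z).card ≤ j} -
          (prodBernoulli w).real {ω : BondConfig V | (A.filter fun z => ω ∈ openConn x z).card ≤ j}) :=
  clusterUpset_transfer w hcx A j (fun _ _ hC h => openConnIn_mono_of_openEdgeCluster hC h) hle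

end CoinReduction

end Summit.CriticalPhenomena.PercolationContinuityZ3.Theorems

end
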